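import Summits.BirchSwinnertonDyer.BirchSwinnertonDyer.Theorems.Rank2Observatory2DescClKillCurveCertE2Rows
import HarnessLib

/-!
# BirchSwinnertonDyer — rank ≥ 2 observatory: KERNEL-2DESC-CL v2.7p — E2 kill rows whose residue search is proved in KILL-PIECE files

HONEST FRAMING: per-curve certified theorems and census instruments; no claim on BSD in rank ≥ 2.

`TwoDescCl.killSearchE2_cons` (`Rank2Observatory2DescClKillCurveCertE2Rows`) prepends ONE residue search
`killCheck k.p F.fe.base.a F.fe.base.b F.fe.base.c (k.z F cc) cc.Xt.2.1 cc.Xt.2.2 k.fuel = true` to the kill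
hypothesis `killSearchE2 F cc ks = true` of a v2.7 row, the search being decided IN the row (one `decide +kernel`,
or `TwoDescKillSplit.killCheck_of_chunks`).  When the residue tree is too big for one file it is proved in
KILL-PIECE files instead (v3.2a, cert-1 gen 25: leaf facts `TwoDescKill.check … = true`, each its own
`decide +kernel`, assembled by the frontier glue `TwoDescKill.killCheck_of_starts` / `check_succ_of_children` of
`Rank2Observatory2DescKillFrontier` into `kill : TwoDescKill.killCheck p a b c z t₁ t₂ fuel = true`) — over
NUMERAL arguments.  `killSearchE2_cons_cast` transports such a fact to the row's arguments along the
equality of the six computed arguments `(a, b, c, z, t₁, t₂)` (the v3.2a `killValidAt_cast` tuple; `k.p` and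
`k.fuel` are projections of the row's kill literal `k`, passed explicitly as `(k := ⟨U, p, fuel⟩)` and unified by
`rfl`), supplied as the BOOLEAN test `decide (… = …) = true` — its `Decidable` instance is fixed here once, over
variables, and the row proves it by `decide +kernel`, so that neither the unifier nor instance synthesis ever
meets `k.z F cc` (a `prodCoords` over `Finset` data) or the curve literal; the kernel evaluates them (the
`ClKillE2.lite` pattern of the E2 definitions).  Purely structural; soundness is untouched (`killSearchE2` is consumed
verbatim by `rank_eq_of_certsE2K_*`).  (cert-1 gen 36.)
[cite: CremonaAlgorithms1997, §3.6] [cite: Cassels1991LecturesEllipticCurves, §15]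
-/

-- single-conjunct summit: `Summit.BirchSwinnertonDyer.BirchSwinnertonDyer.…` repeats the name by design
set_option linter.dupNamespace false

noncomputable section

open scoped Classical NumberField nonZeroDivisors

open Literature.NumberTheory.NumberFields Polynomial Module NumberField IsDedekindDomain Ideal

namespace Summit.BirchSwinnertonDyer.BirchSwinnertonDyer.Rank2Observatory.TwoDescCl

open TwoDescCubic ClFieldCert TwoDescKill

section Cast

variable {F : ClFieldCertE2} {cc : ClCurveCertE2}

/-- Prepend one residue search proved over numeral arguments (a kill-piece assembly `kill`), transported to
the row's arguments along the equality of the argument tuples, given as the kernel-decided Boolean test `e`.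
[folklore] -/
theorem killSearchE2_cons_cast {k : ClKillE2} {ks : List ClKillE2} {a b c t₁ t₂ : ℤ} {z : ℤ × ℤ × ℤ}
    (h₁ : killCheck k.p a b c z t₁ t₂ k.fuel = true)
    (e : decide ((a, b, c, z, t₁, t₂) =
      (F.fe.base.a, F.fe.base.b, F.fe.base.c, k.z F cc, cc.Xt.2.1, cc.Xt.2.2)) = true)
    (h : killSearchE2 F cc ks = true) : killSearchE2 F cc (k :: ks) = true := by
  have e' := of_decide_eq_true e
  simp only [Prod.mk.injEq] at e'
  obtain ⟨rfl, rfl, rfl, rfl, rfl, rfl⟩ := e'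
  exact killSearchE2_cons h₁ h

end Cast

end Summit.BirchSwinnertonDyer.BirchSwinnertonDyer.Rank2Observatory.TwoDescCl

end
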